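import Mathlib

/-!
# `BalabanImbrieJaffe1984to88.BIJ88FTCExpansion305` — T. Bałaban, J. Imbrie, A. Jaffe, *Effective action and cluster properties
of the abelian Higgs model*, Commun. Math. Phys. **114** (1988) 257–315 [BalabanImbrieJaffe1988], §5.13 *Decoupling of the
Small Field Region*, p. 305: the FUNDAMENTAL-THEOREM-OF-CALCULUS EXPANSION that starts (5.13.3) — `⟨Π_i f(□_i)⟩_1 = Σ_{Γ⊂I}
∫ds_Γ (∂/∂s_Γ)⟨Π_i f(□_i)⟩_{s_Γ}` with `s_i = 0` for `i ∉ Γ`, `ds_Γ = Π_{i∈Γ}ds_i`, `∂/∂s_Γ = Π_{i∈Γ}d/ds_i` — PROVED for an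
arbitrary function of finitely many interpolation parameters given together with its mixed partial derivatives

statement-level skeleton of published theorems with citation tags; proofs where landed; nothing here is a claim about the Yang–Mills mass gap

PDF held: `paper:balaban1988-cmp114-bij-abelian-higgs-effective-action` (journal page = PDF page + 256).  Render read this
session: p. 305 = PDF 49 (`pages/original-p049-x2.png` of the p02 seat, read as image).

**What the paper prints (p. 305, verbatim).**  *"To give our expansion, we use the fundamental theorem of calculus to write
⟨Π_{i∈I} f(□_i)⟩_1 = Σ_{Γ⊂I} ∫ ds_Γ (∂/∂s_Γ) ⟨Π_{i∈I} f(□_i)⟩_{s_Γ}. Here s_Γ specifies s_i = 0 for i ∉ Γ, ds_Γ = Π_{i∈Γ} ds_i, ∂/∂s_Γ =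
Π_{i∈Γ} d/ds_i, and ⟨·⟩_{s_Γ} is the expectation with quadratic form Δ_{s_Γ} instead of Δ."*  (The integrations are over
`s_i ∈ [0, 1]`: `⟨·⟩_1` is the value at all `s_i = 1`, cf. `Δ_s` of p. 305 with `Δ_{s≡1} = Δ`.)

**What is reproduced here (kernel-checked, zero `sorry`, no named facts).**  The identity is a statement about ANY real function
`F` of the parameters `s = {s_i}_{i∈I}` possessing continuous mixed partial derivatives in the directions used; the expectation
`⟨Π f(□_i)⟩_s` of the print is one such function (its `s`-derivatives are the Gaussian-integration-by-parts terms displayed next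
on p. 305 — not modelled here).  The mixed partials are carried as a FAMILY `D : Finset I → (I → ℝ) → ℝ` with `D ∅ = F` and
`D (insert k Γ) = ∂_k D Γ` (hypothesis `hderiv`, stated with `HasDerivAt` along the coordinate line), each `D Γ` continuous.
* DEFINITIONS: `iterInt Γ g σ` (`∫ds_Γ g`: the iterated unit-interval integrals `Π_{i∈Γ}∫₀¹ds_i` in the coordinates of the list
  `Γ`, the other coordinates frozen at `σ`), `expansionSum l D σ` (`Σ_{Γ⊂l} ∫ds_Γ D_Γ(s_Γ)` — THE PRINTED RIGHT-HAND SIDE, over the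
  sublists `Γ` of the coordinate list `l`, `s_i = σ_i` off `Γ`), `expansionRec` (the same expansion generated one coordinate at a
  time: `E(i :: l) = E(l)|_{s_i=σ_i} + ∫₀¹ ds_i E(l)[∂_i ·]`), `onePt l σ` (the point `s_i = 1` on `l`, `σ_i` elsewhere).
* **`ftc_expansionRec`** — `F(1 on l, σ off l) = expansionRec l D σ` whenever `σ_i = 0` on `l` (induction on the coordinates:
  one-variable FTC `F|_{s_i=1} = F|_{s_i=0} + ∫₀¹ ∂_iF ds_i` (Mathlib `intervalIntegral.integral_eq_sub_of_hasDerivAt`) applied to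
  `F` and to every `∂_Γ F`).
* **`expansionRec_eq_sum`** — the recursive expansion IS the printed sum over subsets: `expansionRec = expansionSum` (finite
  sums commute with `∫₀¹`; iterated parametric integrals of continuous functions are continuous —
  `intervalIntegral.continuous_parametric_intervalIntegral_of_continuous'`; `I` finite).
* **`ftc_expansion`** — THE PRINTED IDENTITY: `F(1) = Σ_{Γ⊂I} ∫ds_Γ (∂_ΓF)(s_Γ)`, `s_i = 0` off `Γ`, for the full coordinate list
  of a finite `I` (`ftc_expansion_univ`) and for any duplicate-free list `l` with base point `0` on `l`.

**Readings (declared).**  (i) `∫ds_Γ = Π_{i∈Γ}∫₀¹ds_i` as ITERATED integrals in a fixed order of the coordinates (the print's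
product of one-dimensional integrations; equality with the product-measure integral over `[0,1]^Γ` is Fubini and is not needed
here); (ii) differentiability is asked only along coordinate lines and only in the directions of `l`, at every point (more than the
cube `[0,1]^I` — harmless for the smooth functions of the application); (iii) the sum over `Γ ⊂ I` is indexed by the sublists of
the coordinate list (`List.sublists'`), each subset exactly once for a duplicate-free list.

**What is NOT claimed.**  The Gaussian derivative formula (the pairing display of p. 305), (5.13.3) itself (random-walk form),
(5.13.4), any statement about the measures `⟨·⟩_s`; anything of B1–B16.  NOT summit progress; NOT continuum; NOT Clay.  Imports:
Mathlib only; no Summits import; sub-namespace `…BIJ88FTCExpansion305`; modifies nothing.  Cell `lit-balaban` Phase 2, seat p02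
gen 4; row C2.Eq5.13.3-5.13.4 (owner r16), the p. 305 FTC-expansion display «⟨Πf(□_i)⟩_1 = Σ_{Γ⊂I}∫ds_Γ ∂/∂s_Γ⟨Πf(□_i)⟩_{s_Γ}»
→ proved (generic form).
-/

noncomputable section

open scoped BigOperators
open Function MeasureTheory

namespace Literature.MathematicalPhysics.QuantumFieldTheory.BalabanImbrieJaffe1984to88.BIJ88FTCExpansion305

variable {I : Type*} [DecidableEq I]

/-! ## The objects -/

/-- `∫ds_Γ g` (p. 305: *"ds_Γ = Π_{i∈Γ} ds_i"*): the iterated unit-interval integrals in the coordinates of the list `Γ`, the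
remaining coordinates frozen at `σ`. [cite: BalabanImbrieJaffe1988, (5.13.3) p.305] -/
def iterInt : List I → ((I → ℝ) → ℝ) → (I → ℝ) → ℝ
  | [], g, σ => g σ
  | i :: Γ, g, σ => ∫ t in (0 : ℝ)..1, iterInt Γ g (update σ i t)

/-- **the printed right-hand side** `Σ_{Γ⊂I} ∫ds_Γ (∂/∂s_Γ F)(s_Γ)` (p. 305), for a coordinate list `l`, the mixed partials
carried as the family `D` (`D Γ = ∂_Γ F`), coordinates off `Γ` frozen at `σ` (the print: `s_i = 0 for i ∉ Γ`, i.e. `σ = 0`).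
[cite: BalabanImbrieJaffe1988, (5.13.3) p.305] -/
def expansionSum (l : List I) (D : Finset I → (I → ℝ) → ℝ) (σ : I → ℝ) : ℝ :=
  (l.sublists'.map fun Γ => iterInt Γ (D Γ.toFinset) σ).sum

/-- the same expansion generated one coordinate at a time: `E(i :: l)[F] = E(l)[F] + ∫₀¹ ds_i E(l)[∂_iF|_{s_i}]`.
[cite: BalabanImbrieJaffe1988, (5.13.3) p.305] -/
def expansionRec : List I → (Finset I → (I → ℝ) → ℝ) → (I → ℝ) → ℝ
  | [], D, σ => D ∅ σ
  | i :: l, D, σ => expansionRec l D σ + ∫ t in (0 : ℝ)..1, expansionRec l (fun Γ s => D (insert i Γ) (update s i t)) σ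

/-- the evaluation point `⟨·⟩_1`: `s_i = 1` on the coordinates of `l`, `σ_i` elsewhere. [cite: BalabanImbrieJaffe1988, (5.13.3) p.305] -/
def onePt (l : List I) (σ : I → ℝ) : I → ℝ := fun i => if i ∈ l then 1 else σ i

/-- with no coordinates the evaluation point is the base point. [cite: BalabanImbrieJaffe1988, (5.13.3) p.305] -/
@[simp] theorem onePt_nil (σ : I → ℝ) : onePt [] σ = σ := by
  funext i
  simp [onePt]

/-! ## The fundamental theorem of calculus, iterated -/

/-- **The FTC expansion, recursive form**: for a duplicate-free coordinate list `l`, a family `D` of continuous functions with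
`D (insert k Γ) = ∂_k(D Γ)` along every coordinate `k ∈ l`, `k ∉ Γ`, and a base point `σ` vanishing on `l`:
`D ∅ (1 on l, σ off l) = expansionRec l D σ`. [cite: BalabanImbrieJaffe1988, (5.13.3) p.305] -/
theorem ftc_expansionRec : ∀ (l : List I), l.Nodup → ∀ (D : Finset I → (I → ℝ) → ℝ) (σ : I → ℝ),
    (∀ Γ, Continuous (D Γ)) →
    (∀ (Γ : Finset I) (k : I), k ∈ l → k ∉ Γ → ∀ s : I → ℝ,
      HasDerivAt (fun u => D Γ (update s k u)) (D (insert k Γ) s) (s k)) →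
    (∀ i ∈ l, σ i = 0) →
    D ∅ (onePt l σ) = expansionRec l D σ
  | [], _, D, σ, _, _, _ => by simp [expansionRec]
  | (i :: l), hnd, D, σ, hcont, hderiv, hσ => by
      have hil : i ∉ l := (List.nodup_cons.1 hnd).1
      have hl : l.Nodup := (List.nodup_cons.1 hnd).2
      have hmem : ∀ k ∈ l, k ∈ i :: l := fun k hk => List.mem_cons_of_mem i hk
      have hii : i ∈ i :: l := by simp
      set p : I → ℝ := onePt l σ with hp
      have hpi : p i = 0 := by
        simp only [hp, onePt, hil, if_false]
        exact hσ i hii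
      have hpt1 : onePt (i :: l) σ = update p i 1 := by
        funext k
        by_cases hk : k = i
        · subst hk
          simp [onePt]
        · rw [update_of_ne hk]
          simp [onePt, hp, hk]
      have hpt0 : update p i 0 = p := by
        rw [← hpi, update_eq_self]
      -- the one-variable FTC in the coordinate i
      have hFTC : ∫ u in (0 : ℝ)..1, D {i} (update p i u) = D ∅ (update p i 1) - D ∅ (update p i 0) := by
        have h1 : ∀ u ∈ Set.uIcc (0 : ℝ) 1, HasDerivAt (fun u => D ∅ (update p i u)) (D {i} (update p i u)) u := by
          intro u _
          have h := hderiv ∅ i hii (Finset.notMem_empty i) (update p i u)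
          simp only [update_idem, update_self, Finset.insert_empty] at h
          exact h
        have h2 : IntervalIntegrable (fun u => D {i} (update p i u)) volume 0 1 :=
          ((hcont {i}).comp (continuous_const.update i continuous_id)).intervalIntegrable _ _
        exact intervalIntegral.integral_eq_sub_of_hasDerivAt h1 h2
      -- the induction hypothesis for F itself …
      have hIH0 : D ∅ p = expansionRec l D σ :=
        ftc_expansionRec l hl D σ hcont (fun Γ k hk hkΓ s => hderiv Γ k (hmem k hk) hkΓ s) (fun k hk => hσ k (hmem k hk))
      -- … and for the families ∂_i(·)|_{s_i = u}
      have hIHu : ∀ u : ℝ, D {i} (update p i u) = expansionRec l (fun Γ s => D (insert i Γ) (update s i u)) σ := by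
        intro u
        have h := ftc_expansionRec l hl (fun Γ s => D (insert i Γ) (update s i u)) σ
          (fun Γ => (hcont _).comp (continuous_id.update i continuous_const))
          (fun Γ k hk hkΓ s => by
            have hki : k ≠ i := fun e => hil (e ▸ hk)
            have hik : i ≠ k := fun e => hki e.symm
            have hnot : k ∉ insert i Γ := by simp [hki, hkΓ]
            have h2 := hderiv (insert i Γ) k (hmem k hk) hnot (update s i u)
            rw [update_of_ne hki] at h2
            simp_rw [update_comm hik] at h2
            rw [Finset.insert_comm] at h2
            exact h2)
          (fun k hk => hσ k (hmem k hk))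
        simpa [hp] using h
      rw [hpt1, expansionRec, ← hIH0]
      have hsplit : D ∅ (update p i 1) = D ∅ p + ∫ u in (0 : ℝ)..1, D {i} (update p i u) := by
        rw [hFTC, hpt0]
        ring
      rw [hsplit, intervalIntegral.integral_congr fun u _ => hIHu u]

/-! ## The recursive expansion is the printed sum over subsets -/

/-- integrating in a coordinate `i ∉ Γ` commutes with `∫ds_Γ`. [cite: BalabanImbrieJaffe1988, (5.13.3) p.305] -/
theorem iterInt_update : ∀ (Γ : List I) (g : (I → ℝ) → ℝ) (i : I), i ∉ Γ → ∀ (t : ℝ) (σ : I → ℝ),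
    iterInt Γ (fun s => g (update s i t)) σ = iterInt Γ g (update σ i t)
  | [], g, i, _, t, σ => rfl
  | (k :: Γ), g, i, hi, t, σ => by
      have hki : k ≠ i := fun e => hi (e ▸ List.mem_cons_self ..)
      have hiΓ : i ∉ Γ := fun h => hi (List.mem_cons_of_mem k h)
      simp only [iterInt]
      refine intervalIntegral.integral_congr fun u _ => ?_
      show iterInt Γ (fun s => g (update s i t)) (update σ k u) = iterInt Γ g (update (update σ i t) k u)
      rw [iterInt_update Γ g i hiΓ t (update σ k u), update_comm hki]

/-- `∫ds_Γ g` depends continuously on the frozen coordinates when `g` is continuous (iterated parametric integrals).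
[cite: BalabanImbrieJaffe1988, (5.13.3) p.305] -/
theorem continuous_iterInt : ∀ (Γ : List I) {g : (I → ℝ) → ℝ}, Continuous g → Continuous (iterInt Γ g)
  | [], _, hg => hg
  | (i :: Γ), g, hg => by
      have hG := continuous_iterInt Γ hg
      have hunc : Continuous (Function.uncurry fun (σ : I → ℝ) (t : ℝ) => iterInt Γ g (update σ i t)) :=
        hG.comp (continuous_fst.update i continuous_snd)
      simpa [iterInt] using intervalIntegral.continuous_parametric_intervalIntegral_of_continuous' (μ := volume) hunc 0 1

/-- finite (list-indexed) sums commute with `∫₀¹` for continuous integrands. [cite: BalabanImbrieJaffe1988, (5.13.3) p.305] -/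
theorem integral_list_sum {κ : Type*} : ∀ (L : List κ) (f : κ → ℝ → ℝ), (∀ x ∈ L, Continuous (f x)) →
    (∫ t in (0 : ℝ)..1, (L.map fun x => f x t).sum) = (L.map fun x => ∫ t in (0 : ℝ)..1, f x t).sum
  | [], _, _ => by simp
  | (x :: L), f, hf => by
      have hx : Continuous (f x) := hf x (by simp)
      have hL : ∀ y ∈ L, Continuous (f y) := fun y hy => hf y (List.mem_cons_of_mem x hy)
      have hsum : Continuous fun t => (L.map fun y => f y t).sum := continuous_list_sum L fun y hy => hL y hy
      simp only [List.map_cons, List.sum_cons]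
      rw [intervalIntegral.integral_add (hx.intervalIntegrable 0 1) (hsum.intervalIntegrable 0 1), integral_list_sum L f hL]

/-- **The recursive expansion is the printed sum** `Σ_{Γ⊂l} ∫ds_Γ D_Γ(s_Γ)` (for a duplicate-free `l` and continuous `D Γ`).
[cite: BalabanImbrieJaffe1988, (5.13.3) p.305] -/
theorem expansionRec_eq_sum : ∀ (l : List I), l.Nodup → ∀ (D : Finset I → (I → ℝ) → ℝ) (σ : I → ℝ),
    (∀ Γ, Continuous (D Γ)) → expansionRec l D σ = expansionSum l D σ
  | [], _, D, σ, _ => by simp [expansionRec, expansionSum, iterInt]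
  | (i :: l), hnd, D, σ, hcont => by
      have hil : i ∉ l := (List.nodup_cons.1 hnd).1
      have hl : l.Nodup := (List.nodup_cons.1 hnd).2
      rw [expansionRec, expansionRec_eq_sum l hl D σ hcont]
      have hu : ∀ u : ℝ, expansionRec l (fun Γ s => D (insert i Γ) (update s i u)) σ
          = (l.sublists'.map fun Γ => iterInt Γ (D (insert i Γ.toFinset)) (update σ i u)).sum := by
        intro u
        rw [expansionRec_eq_sum l hl (fun Γ s => D (insert i Γ) (update s i u)) σ
          (fun Γ => (hcont _).comp (continuous_id.update i continuous_const)), expansionSum]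
        congr 1
        refine List.map_congr_left fun Γ hΓ => ?_
        have hiΓ : i ∉ Γ := fun h => hil ((List.mem_sublists'.1 hΓ).subset h)
        exact iterInt_update Γ _ i hiΓ u σ
      rw [intervalIntegral.integral_congr fun u _ => hu u]
      rw [integral_list_sum l.sublists' (fun Γ u => iterInt Γ (D (insert i Γ.toFinset)) (update σ i u))
        (fun Γ _ => (continuous_iterInt Γ (hcont _)).comp (continuous_const.update i continuous_id))]
      simp only [expansionSum, List.sublists'_cons, List.map_append, List.sum_append, List.map_map]
      congr 1
      refine congrArg List.sum (List.map_congr_left fun Γ _ => ?_)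
      simp [iterInt, List.toFinset_cons]

/-- **p. 305, the FTC expansion** — for a duplicate-free coordinate list `l`, a continuous family `D` with `D (insert k Γ) = ∂_kD Γ`
(`k ∈ l`, `k ∉ Γ`) and a base point `σ` vanishing on `l`:
`D ∅ (1 on l, σ elsewhere) = Σ_{Γ⊂l} ∫ds_Γ (D Γ)(s_Γ)` (`s_i = σ_i = 0` off `Γ` on `l`). [cite: BalabanImbrieJaffe1988, (5.13.3) p.305] -/
theorem ftc_expansion (l : List I) (hl : l.Nodup) (D : Finset I → (I → ℝ) → ℝ) (σ : I → ℝ) (hcont : ∀ Γ, Continuous (D Γ))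
    (hderiv : ∀ (Γ : Finset I) (k : I), k ∈ l → k ∉ Γ → ∀ s : I → ℝ,
      HasDerivAt (fun u => D Γ (update s k u)) (D (insert k Γ) s) (s k))
    (hσ : ∀ i ∈ l, σ i = 0) :
    D ∅ (onePt l σ) = expansionSum l D σ := by
  rw [ftc_expansionRec l hl D σ hcont hderiv hσ, expansionRec_eq_sum l hl D σ hcont]

/-- **p. 305, verbatim**: *"⟨Π_{i∈I} f(□_i)⟩_1 = Σ_{Γ⊂I} ∫ds_Γ (∂/∂s_Γ)⟨Π_{i∈I} f(□_i)⟩_{s_Γ}. Here s_Γ specifies s_i = 0 for i ∉ Γ,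
ds_Γ = Π_{i∈Γ}ds_i, ∂/∂s_Γ = Π_{i∈Γ}d/ds_i"* — PROVED for every function `F = D ∅` of the finitely many parameters `s ∈ ℝ^I`
with continuous mixed partials `D Γ = ∂_ΓF` along the coordinate lines: `F(1,…,1) = Σ_{Γ⊂I} ∫ds_Γ (∂_ΓF)(s_Γ)`, the sum running
over the sublists of the coordinate list `univ.toList`. [cite: BalabanImbrieJaffe1988, (5.13.3) p.305] -/
theorem ftc_expansion_univ [Fintype I] (D : Finset I → (I → ℝ) → ℝ) (hcont : ∀ Γ, Continuous (D Γ))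
    (hderiv : ∀ (Γ : Finset I) (k : I), k ∉ Γ → ∀ s : I → ℝ,
      HasDerivAt (fun u => D Γ (update s k u)) (D (insert k Γ) s) (s k)) :
    D ∅ (fun _ => 1) = expansionSum (Finset.univ : Finset I).toList D 0 := by
  have h := ftc_expansion (Finset.univ : Finset I).toList (Finset.nodup_toList _) D 0 hcont
    (fun Γ k _ hk s => hderiv Γ k hk s) (fun _ _ => rfl)
  have hpt : onePt (Finset.univ : Finset I).toList (0 : I → ℝ) = fun _ => 1 := by
    funext i
    simp [onePt]
  rw [hpt] at h
  exact h

/-! ## Non-vacuity: one parameter -/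

/-- One coordinate (`I = Unit`, `l = [()]`): the expansion is `F(0) + ∫₀¹ F′(s) ds` — the ordinary fundamental theorem of
calculus, here for `F(s) = s²` with `F′ = 2s`, `F″ = 2`. -/
example : expansionSum [()] (fun Γ (s : Unit → ℝ) => if Γ = ∅ then s () ^ 2 else if Γ = {()} then 2 * s () else 2) 0
    = (fun (s : Unit → ℝ) => s () ^ 2) (fun _ => 1) := by
  symm
  have h := ftc_expansion (I := Unit) [()] (by simp)
    (fun Γ (s : Unit → ℝ) => if Γ = ∅ then s () ^ 2 else if Γ = {()} then 2 * s () else 2) 0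
    (fun Γ => by
      split_ifs
      · exact (continuous_apply ()).pow 2
      · exact continuous_const.mul (continuous_apply ())
      · exact continuous_const)
    (fun Γ k _ hk s => by
      obtain rfl : k = () := rfl
      have hΓ : Γ = ∅ := by
        rcases Finset.eq_empty_or_nonempty Γ with h | ⟨x, hx⟩
        · exact h
        · exact absurd (by obtain rfl : x = () := rfl; exact hx) hk
      subst hΓ
      simp only [if_true, Finset.insert_empty, Finset.singleton_ne_empty, if_false, update_self]
      have hd : HasDerivAt (fun u : ℝ => u ^ 2) (2 * s ()) (s ()) := by
        simpa using hasDerivAt_pow 2 (s ())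
      exact hd)
    (fun _ _ => rfl)
  simpa [onePt] using h

end Literature.MathematicalPhysics.QuantumFieldTheory.BalabanImbrieJaffe1984to88.BIJ88FTCExpansion305

end
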